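import Literature.NumberTheory.Automorphic.ZariskiGL
import Literature.NumberTheory.Automorphic.TorusCharacters
import Literature.NumberTheory.Automorphic.DiagonalizableGroups
import HarnessLib

/-!
# Rigidity of tori and conjugation transport for subgroups of `GL n` (Springer 3.2.8–3.2.9)

Trunk T-AUTOMORPHIC (G25 AutomorphicL); theorems-only companion of `LinearAlgebraicGroups.lean`,
`IdentityComponent.lean`, `ZariskiGL.lean` and `TorusCharacters.lean` (namespace
`Literature.Automorphic`, concrete `k`-points vocabulary: subgroups of `GL n k`, `IsAlgebraicSubgroup`,
`IsZConnected`, `IsTorusSubgroup`, `IsMaximalTorusIn`, `IsBorelIn`). It supplies two inputs of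
the structure theory of reductive groups used for Springer 8.1.1 (i) (`rootSubgroup_unique`,
file `RootSubgroupStructure.lean`):

* **Transport along inner automorphisms** (Springer 2.1.2: `Int g` is an automorphism of
  algebraic groups): `IsZConnected.map_conj`, `IsTorusSubgroup.map_conj`,
  `IsMaximalTorusIn.map_conj`, `IsBorelIn.map_conj`, `isSolvable_map_conj`,
  `IsSemisimpleElt.conj`; the normaliser of an algebraic subgroup is algebraic
  (`IsAlgebraicSubgroup.normalizer`).
* **Rigidity** (Springer 3.2.8, in the form 3.2.9 `N_G(T)° = Z_G(T)°`):
  `IsZConnected.le_centralizer_of_le_normalizer` — over an algebraically closed field a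
  Zariski-connected subgroup normalising a commutative subgroup `T` of semisimple matrices
  centralises it. The proof given here is the orbit argument: for `t ∈ T` the conjugates
  `h t h⁻¹`, `h ∈ H`, form an irreducible (`IsZConnected.isIrreducible`, 2.2.1) subset of the
  set of elements of `T` conjugate to `t`, which is finite (`finite_mem_and_isConj`: after
  simultaneous diagonalisation, 2.4.2 (ii), these are diagonal matrices whose entries are roots
  of the characteristic polynomial of `t`); an irreducible finite set of closed points is a point.
  Consequence (`exists_pow_mem_centralizer_of_le_normalizer`, 3.2.9 with 2.2.1): every element
  of an algebraic `M ⊆ N(T)` has a positive power in `Z(T)` — the finiteness of Weyl groups in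
  the form needed for 7.1.4.

## Mathlib

Conjugation is Mathlib's `MulAut.conj`, with `Subgroup.map`, `Subgroup.normalizer`,
`Subgroup.centralizer`, `Subgroup.relIndex_map_map_of_injective`,
`Subgroup.exists_pow_mem_of_index_ne_zero`; similarity invariance of semisimplicity is
`LinearEquiv.isSemisimple_iff`, of the characteristic polynomial `Matrix.charpoly_units_conj`;
irreducibility is Mathlib's `IsIrreducible` (`IsIrreducible.image`,
`isIrreducible_iff_sUnion_isClosed`) for the Zariski topology `zariskiTopologyGL` of
`ZariskiGL.lean` (a local instance). Mathlib has no algebraic groups; nothing here duplicates a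
Mathlib declaration (searched `rigidity`, `normalizer` + `torus`, `centralizer` + `connected`).

## References

* [SpringerLAG1998] T. A. Springer, *Linear Algebraic Groups*, 2nd ed., Progress in
  Mathematics 9, Birkhäuser (1998): 2.1.2, 2.2.1, 2.4.2 (ii), 3.2.8 (rigidity of diagonalisable
  groups), 3.2.9 (`N_G(H)° = Z_G(H)°`), 6.2.1, 6.4.
-/

open scoped MatrixGroups

namespace Literature.NumberTheory.Automorphic

variable {k : Type*} [Field k] {n : Type*} [Fintype n] [DecidableEq n]

attribute [local instance] zariskiTopologyGL

/-! ### Conjugates of subgroups: transport of structure along `Int g` -/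

section ConjTransport

/-- Membership in a conjugate subgroup: `x ∈ g H g⁻¹ ↔ g⁻¹ x g ∈ H`. [folklore] -/
lemma mem_map_conj_iff {H : Subgroup (GL n k)} {g x : GL n k} :
    x ∈ H.map (MulAut.conj g : GL n k →* GL n k) ↔ g⁻¹ * x * g ∈ H := by
  rw [← MulEquiv.toMonoidHom_eq_coe, Subgroup.mem_map_equiv, MulAut.conj_symm_apply]

/-- A conjugate of an algebraic subgroup is algebraic (`IsAlgebraicSubgroup.map_conj` of
`IdentityComponent.lean`, restated for the coercion `(MulAut.conj h : GL n k →* GL n k)`).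
[folklore] -/
theorem IsAlgebraicSubgroup.map_conj' {K : Subgroup (GL n k)} (hK : IsAlgebraicSubgroup K)
    (h : GL n k) : IsAlgebraicSubgroup (K.map (MulAut.conj h : GL n k →* GL n k)) := by
  rw [← MulEquiv.toMonoidHom_eq_coe]
  exact hK.map_conj h

/-- `g h g⁻¹ ∈ g H g⁻¹` for `h ∈ H`. [folklore] -/
lemma conj_mem_map_conj {H : Subgroup (GL n k)} {h : GL n k} (hh : h ∈ H) (g : GL n k) :
    g * h * g⁻¹ ∈ H.map (MulAut.conj g : GL n k →* GL n k) := by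
  rw [mem_map_conj_iff]
  simpa [mul_assoc] using hh

/-- Conjugating back: `g⁻¹ (g H g⁻¹) g = H`. [folklore] -/
lemma map_conj_inv_map_conj (H : Subgroup (GL n k)) (g : GL n k) :
    (H.map (MulAut.conj g : GL n k →* GL n k)).map (MulAut.conj g⁻¹ : GL n k →* GL n k) =
      H := by
  ext x
  simp [mul_assoc]

/-- Conjugating back: `g (g⁻¹ H g) g⁻¹ = H`. [folklore] -/
lemma map_conj_map_conj_inv (H : Subgroup (GL n k)) (g : GL n k) :
    (H.map (MulAut.conj g⁻¹ : GL n k →* GL n k)).map (MulAut.conj g : GL n k →* GL n k) =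
      H := by
  have h := map_conj_inv_map_conj H g⁻¹
  rwa [inv_inv] at h

/-- Iterated conjugation: `g' (g H g⁻¹) g'⁻¹ = (g' g) H (g' g)⁻¹`. [folklore] -/
lemma map_conj_map_conj (H : Subgroup (GL n k)) (g g' : GL n k) :
    (H.map (MulAut.conj g : GL n k →* GL n k)).map (MulAut.conj g' : GL n k →* GL n k) =
      H.map (MulAut.conj (g' * g) : GL n k →* GL n k) := by
  ext x
  simp [mul_assoc]

/-- Conjugation is monotone on subgroups. [folklore] -/
lemma map_conj_le_map_conj_iff {H K : Subgroup (GL n k)} {g : GL n k} :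
    H.map (MulAut.conj g : GL n k →* GL n k) ≤ K.map (MulAut.conj g : GL n k →* GL n k) ↔
      H ≤ K :=
  Subgroup.map_le_map_iff_of_injective (MulAut.conj g).injective

/-- The relative index is invariant under conjugation. [folklore] -/
lemma relIndex_map_conj (H K : Subgroup (GL n k)) (g : GL n k) :
    (H.map (MulAut.conj g : GL n k →* GL n k)).relIndex
      (K.map (MulAut.conj g : GL n k →* GL n k)) = H.relIndex K :=
  Subgroup.relIndex_map_map_of_injective H K (MulAut.conj g).injective

/-- A conjugate of a Zariski-connected subgroup is Zariski-connected (Springer 2.2.1 with 2.1.2: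
inner automorphisms are automorphisms of algebraic groups). [folklore] -/
theorem IsZConnected.map_conj {H : Subgroup (GL n k)} (hH : IsZConnected H) (g : GL n k) :
    IsZConnected (H.map (MulAut.conj g : GL n k →* GL n k)) := by
  refine ⟨hH.1.map_conj' g, fun K hK hKalg hKfi => ?_⟩
  -- pull `K` back to an algebraic finite-index subgroup of `H`
  have hK' : K.map (MulAut.conj g⁻¹ : GL n k →* GL n k) ≤ H := by
    have h := Subgroup.map_mono (f := (MulAut.conj g⁻¹ : GL n k →* GL n k)) hK
    rwa [map_conj_inv_map_conj] at h
  have hfi' : ((K.map (MulAut.conj g⁻¹ : GL n k →* GL n k)).subgroupOf H).FiniteIndex := by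
    constructor
    change (K.map (MulAut.conj g⁻¹ : GL n k →* GL n k)).relIndex H ≠ 0
    rw [← relIndex_map_conj _ _ g, map_conj_map_conj_inv]
    exact hKfi.index_ne_zero
  have heq := hH.2 _ hK' (hKalg.map_conj' g⁻¹) hfi'
  rw [← heq, map_conj_map_conj_inv]

/-- Semisimplicity of a matrix is invariant under conjugation (similar matrices). [folklore] -/
theorem IsSemisimpleElt.conj {x : GL n k} (hx : IsSemisimpleElt x) (g : GL n k) :
    IsSemisimpleElt (g * x * g⁻¹) := by
  unfold IsSemisimpleElt at hx ⊢
  let e : (n → k) ≃ₗ[k] (n → k) :=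
    LinearEquiv.ofLinear (Matrix.toLin' (g : Matrix n n k))
      (Matrix.toLin' ((g⁻¹ : GL n k) : Matrix n n k))
      (by rw [← Matrix.toLin'_mul, ← Units.val_mul, mul_inv_cancel, Units.val_one,
        Matrix.toLin'_one])
      (by rw [← Matrix.toLin'_mul, ← Units.val_mul, inv_mul_cancel, Units.val_one,
        Matrix.toLin'_one])
  refine (LinearEquiv.isSemisimple_iff (Matrix.toLin' (x : Matrix n n k))
    (Matrix.toLin' ((g * x * g⁻¹ : GL n k) : Matrix n n k)) e ?_).1 hx
  change Matrix.toLin' (g : Matrix n n k) ∘ₗ Matrix.toLin' (x : Matrix n n k) =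
    Matrix.toLin' ((g * x * g⁻¹ : GL n k) : Matrix n n k) ∘ₗ Matrix.toLin' (g : Matrix n n k)
  rw [← Matrix.toLin'_mul, ← Matrix.toLin'_mul, ← Units.val_mul, ← Units.val_mul,
    inv_mul_cancel_right]

/-- A conjugate of a torus is a torus. [folklore] -/
theorem IsTorusSubgroup.map_conj {T : Subgroup (GL n k)} (hT : IsTorusSubgroup T) (g : GL n k) :
    IsTorusSubgroup (T.map (MulAut.conj g : GL n k →* GL n k)) := by
  refine ⟨hT.1.map_conj g, ⟨⟨fun a b => Subtype.ext ?_⟩⟩, fun t ht => ?_⟩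
  · have ha := a.2
    have hb := b.2
    rw [mem_map_conj_iff] at ha hb
    have h := congrArg Subtype.val (hT.2.1.is_comm.comm ⟨_, ha⟩ ⟨_, hb⟩)
    simp only [Subgroup.coe_mul] at h
    have h' := congrArg (fun y => g * y * g⁻¹) h
    change (a : GL n k) * b = b * a
    simpa [mul_assoc] using h'
  · rw [mem_map_conj_iff] at ht
    simpa [mul_assoc] using (hT.2.2 _ ht).conj g

/-- Solvability is invariant under conjugation. [folklore] -/
theorem isSolvable_map_conj {H : Subgroup (GL n k)} (hH : IsSolvable ↥H) (g : GL n k) :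
    IsSolvable ↥(H.map (MulAut.conj g : GL n k →* GL n k)) :=
  solvable_of_surjective ((MulAut.conj g : GL n k →* GL n k).subgroupMap_surjective H)

/-- A conjugate of a maximal torus of `G` is a maximal torus of the conjugate of `G`. [folklore] -/
theorem IsMaximalTorusIn.map_conj {T G : Subgroup (GL n k)} (hT : IsMaximalTorusIn T G)
    (g : GL n k) :
    IsMaximalTorusIn (T.map (MulAut.conj g : GL n k →* GL n k))
      (G.map (MulAut.conj g : GL n k →* GL n k)) := by
  refine ⟨Subgroup.map_mono hT.1, hT.2.1.map_conj g, fun T' hTT' hT'G hT' => ?_⟩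
  have h1 : T ≤ T'.map (MulAut.conj g⁻¹ : GL n k →* GL n k) := by
    have h := Subgroup.map_mono (f := (MulAut.conj g⁻¹ : GL n k →* GL n k)) hTT'
    rwa [map_conj_inv_map_conj] at h
  have h2 : T'.map (MulAut.conj g⁻¹ : GL n k →* GL n k) ≤ G := by
    have h := Subgroup.map_mono (f := (MulAut.conj g⁻¹ : GL n k →* GL n k)) hT'G
    rwa [map_conj_inv_map_conj] at h
  have h := hT.2.2 _ h1 h2 (hT'.map_conj g⁻¹)
  rw [← h, map_conj_map_conj_inv]

/-- A conjugate of a Borel subgroup of `G` by an element of `G` is a Borel subgroup of `G`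
(Springer 6.2.1). [folklore] -/
theorem IsBorelIn.map_conj {B G : Subgroup (GL n k)} (hB : IsBorelIn B G) {g : GL n k}
    (hg : g ∈ G) : IsBorelIn (B.map (MulAut.conj g : GL n k →* GL n k)) G := by
  obtain ⟨hBG, hBc, hBs, hmax⟩ := hB
  refine ⟨?_, hBc.map_conj g, isSolvable_map_conj hBs g, fun B' hBB' hB'G hB'c hB's => ?_⟩
  · calc B.map (MulAut.conj g : GL n k →* GL n k)
        ≤ G.map (MulAut.conj g : GL n k →* GL n k) := Subgroup.map_mono hBG
      _ = G := Subgroup.mem_normalizer_iff_map_conj_eq.1 (Subgroup.le_normalizer hg)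
  · have h1 : B ≤ B'.map (MulAut.conj g⁻¹ : GL n k →* GL n k) := by
      have h := Subgroup.map_mono (f := (MulAut.conj g⁻¹ : GL n k →* GL n k)) hBB'
      rwa [map_conj_inv_map_conj] at h
    have h2 : B'.map (MulAut.conj g⁻¹ : GL n k →* GL n k) ≤ G := by
      calc B'.map (MulAut.conj g⁻¹ : GL n k →* GL n k)
          ≤ G.map (MulAut.conj g⁻¹ : GL n k →* GL n k) := Subgroup.map_mono hB'G
        _ = G := Subgroup.mem_normalizer_iff_map_conj_eq.1 (Subgroup.le_normalizer (G.inv_mem hg))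
    have h := hmax _ h1 h2 (hB'c.map_conj g⁻¹) (isSolvable_map_conj hB's g⁻¹)
    rw [← h, map_conj_map_conj_inv]

end ConjTransport

/-! ### Normalisers of algebraic subgroups are algebraic -/

section Normalizer

/-- The conjugation map `g ↦ g t g⁻¹` is polynomial. [folklore] -/
lemma isPolyMapGL_conj_apply (t : GL n k) : IsPolyMapGL fun g : GL n k => g * t * g⁻¹ :=
  (isPolyMapGL_id.mul (isPolyMapGL_const t)).mul isPolyMapGL_id.inv

/-- The conjugation map `g ↦ g⁻¹ t g` is polynomial. [folklore] -/
lemma isPolyMapGL_inv_conj_apply (t : GL n k) : IsPolyMapGL fun g : GL n k => g⁻¹ * t * g :=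
  (isPolyMapGL_id.inv.mul (isPolyMapGL_const t)).mul isPolyMapGL_id

/-- The normaliser of an algebraic subgroup of `GL n k` is algebraic (Springer 2.2.4 (ii) for
closed `H`: `N(H) = ⋂_{h ∈ H} {g | g h g⁻¹ ∈ H, g⁻¹ h g ∈ H}` is closed).
[folklore] -/
theorem IsAlgebraicSubgroup.normalizer {H : Subgroup (GL n k)} (hH : IsAlgebraicSubgroup H) :
    IsAlgebraicSubgroup (Subgroup.normalizer (H : Set (GL n k))) := by
  rw [isAlgebraicSubgroup_iff_isClosed] at hH ⊢
  have hset : ((Subgroup.normalizer (H : Set (GL n k)) : Subgroup (GL n k)) : Set (GL n k)) =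
      (⋂ h ∈ H, (fun g : GL n k => g * h * g⁻¹) ⁻¹' (H : Set (GL n k))) ∩
        ⋂ h ∈ H, (fun g : GL n k => g⁻¹ * h * g) ⁻¹' (H : Set (GL n k)) := by
    ext g
    simp only [SetLike.mem_coe, Subgroup.mem_normalizer_iff, Set.mem_inter_iff, Set.mem_iInter,
      Set.mem_preimage]
    constructor
    · intro hg
      refine ⟨fun h hh => (hg h).1 hh, fun h hh => (hg _).2 ?_⟩
      simpa [mul_assoc] using hh
    · rintro ⟨h₁, h₂⟩ h
      refine ⟨h₁ h, fun hh => ?_⟩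
      simpa [mul_assoc] using h₂ _ hh
  rw [hset]
  exact (isClosed_biInter fun h _ => hH.preimage (isPolyMapGL_conj_apply h).continuous).inter
    (isClosed_biInter fun h _ => hH.preimage (isPolyMapGL_inv_conj_apply h).continuous)

end Normalizer

/-! ### Rigidity: a connected group normalising a torus centralises it (Springer 3.2.8–3.2.9) -/

section Rigidity

variable {T : Subgroup (GL n k)}

/-- Over an algebraically closed field, the elements of a commutative subgroup `T ≤ GL n k` of
semisimple matrices that are conjugate (in `GL n k`) to a fixed matrix `t` form a finite set:
after simultaneous diagonalisation of `T` (Springer 2.4.2 (ii)) they are diagonal matrices whose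
entries are roots of the characteristic polynomial of `t`. [folklore] -/
theorem finite_mem_and_isConj [IsAlgClosed k] (hcomm : IsMulCommutative ↥T)
    (hss : ∀ t ∈ T, IsSemisimpleElt t) (t : GL n k) :
    {s : GL n k | s ∈ T ∧ ∃ h : GL n k, s = h * t * h⁻¹}.Finite := by
  classical
  obtain ⟨P, hP⟩ := exists_conj_le_diagonalSubgroup hcomm hss
  rw [MulEquiv.toMonoidHom_eq_coe] at hP
  -- the roots of the characteristic polynomial of `t`
  set R : Set k := {c | (Matrix.charpoly (t : Matrix n n k)).IsRoot c} with hR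
  have hRfin : R.Finite :=
    Polynomial.finite_setOf_isRoot (Matrix.charpoly_monic (t : Matrix n n k)).ne_zero
  -- diagonal matrices with entries in `R`
  set D : Set (n → kˣ) := {d | ∀ i, (d i : k) ∈ R} with hD
  have hDfin : D.Finite := by
    have hinj : Function.Injective fun (d : n → kˣ) (i : n) => (d i : k) :=
      fun d d' h => funext fun i => Units.ext (congrFun h i)
    have hpi : (Set.univ.pi fun _ : n => R).Finite := Set.Finite.pi fun _ => hRfin
    refine (hpi.preimage hinj.injOn).subset ?_
    intro d hd
    simpa [Set.mem_pi, D] using hd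
  refine ((hDfin.image fun d => P⁻¹ * diagonalGL n k d * P)).subset ?_
  rintro s ⟨hs, h, rfl⟩
  -- `P s P⁻¹` is diagonal
  have hmem : P * (h * t * h⁻¹) * P⁻¹ ∈ diagonalSubgroup n k := hP (conj_mem_map_conj hs P)
  obtain ⟨d, hd⟩ := hmem
  refine ⟨d, fun i => ?_, ?_⟩
  · -- `d i` is a root of `charpoly t = charpoly (diag d)`
    have hcp : Matrix.charpoly (t : Matrix n n k) =
        Matrix.charpoly ((diagonalGL n k d : GL n k) : Matrix n n k) := by
      rw [hd]
      simp only [Units.val_mul, Matrix.coe_units_inv, Matrix.charpoly_units_conj]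
    simp only [R, Set.mem_setOf_eq, hcp, coe_diagonalGL, Matrix.charpoly_diagonal,
      Polynomial.IsRoot.def, Polynomial.eval_prod, Polynomial.eval_sub, Polynomial.eval_X,
      Polynomial.eval_C]
    exact Finset.prod_eq_zero (Finset.mem_univ i) (sub_self _)
  · change P⁻¹ * diagonalGL n k d * P = h * t * h⁻¹
    rw [hd]
    simp [mul_assoc]

/-- **Rigidity of tori** (Springer 3.2.8, in the form of 3.2.9: `N_G(T)° ⊆ Z_G(T)`). Over an
algebraically closed field, a Zariski-connected subgroup `H ≤ GL n k` normalising a commutative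
subgroup `T` of semisimple matrices (e.g. a torus) centralises it: for `t ∈ T` the orbit
`{h t h⁻¹ | h ∈ H}` is an irreducible subset of the finite set of elements of `T` conjugate to
`t`, hence reduced to `t`. [cite: SpringerLAG1998, 3.2.8–3.2.9] -/
theorem IsZConnected.le_centralizer_of_le_normalizer [IsAlgClosed k] {H : Subgroup (GL n k)}
    (hH : IsZConnected H) (hcomm : IsMulCommutative ↥T) (hss : ∀ t ∈ T, IsSemisimpleElt t)
    (hHT : H ≤ Subgroup.normalizer (T : Set (GL n k))) :
    H ≤ Subgroup.centralizer (T : Set (GL n k)) := by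
  classical
  intro h hh
  rw [Subgroup.mem_centralizer_iff]
  intro t ht
  set φ : GL n k → GL n k := fun g => g * t * g⁻¹ with hφ
  have hirr : IsIrreducible (φ '' (H : Set (GL n k))) :=
    hH.isIrreducible.image φ (isPolyMapGL_conj_apply t).continuous.continuousOn
  have hsub : φ '' (H : Set (GL n k)) ⊆
      {s : GL n k | s ∈ T ∧ ∃ g : GL n k, s = g * t * g⁻¹} := by
    rintro _ ⟨g, hg, rfl⟩
    exact ⟨(Subgroup.mem_normalizer_iff.1 (hHT hg) t).1 ht, g, rfl⟩
  have hfin : (φ '' (H : Set (GL n k))).Finite := (finite_mem_and_isConj hcomm hss t).subset hsub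
  -- an irreducible finite set (points are closed) is a single point
  obtain ⟨z, hz, hφz⟩ := isIrreducible_iff_sUnion_isClosed.1 hirr
    (hfin.toFinset.image fun s => ({s} : Set (GL n k)))
    (by
      intro z hz
      obtain ⟨s, -, rfl⟩ := Finset.mem_image.1 hz
      exact isClosed_singleton_zariski s)
    (by
      intro x hx
      refine Set.mem_sUnion.2 ⟨{x}, ?_, Set.mem_singleton x⟩
      exact Finset.mem_coe.2 (Finset.mem_image.2 ⟨x, hfin.mem_toFinset.2 hx, rfl⟩))
  obtain ⟨s₀, -, rfl⟩ := Finset.mem_image.1 hz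
  have h1 : φ 1 ∈ ({s₀} : Set (GL n k)) := hφz ⟨1, H.one_mem, rfl⟩
  have h2 : φ h ∈ ({s₀} : Set (GL n k)) := hφz ⟨h, hh, rfl⟩
  rw [Set.mem_singleton_iff] at h1 h2
  have h12 : h * t * h⁻¹ = t := by
    have : φ h = φ 1 := h2.trans h1.symm
    simpa [φ] using this
  calc t * h = h * t * h⁻¹ * h := by rw [h12]
    _ = h * t := by group

/-- **Finiteness of the Weyl group, in the form needed below** (Springer 3.2.9 with 2.2.1: the
identity component of an algebraic `M ⊆ N(T)` centralises `T` and has finite index in `M`):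
every element of an algebraic subgroup `M ≤ GL n k` normalising a commutative subgroup `T` of
semisimple matrices has a positive power centralising `T`. [cite: SpringerLAG1998, 3.2.9] -/
theorem exists_pow_mem_centralizer_of_le_normalizer [IsAlgClosed k] {M : Subgroup (GL n k)}
    (hM : IsAlgebraicSubgroup M) (hcomm : IsMulCommutative ↥T)
    (hss : ∀ t ∈ T, IsSemisimpleElt t)
    (hMT : M ≤ Subgroup.normalizer (T : Set (GL n k))) {m : GL n k} (hm : m ∈ M) :
    ∃ j : ℕ, 0 < j ∧ m ^ j ∈ Subgroup.centralizer (T : Set (GL n k)) := by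
  have hle := (isZConnected_identityComponent hM).le_centralizer_of_le_normalizer hcomm hss
    ((identityComponent_le M).trans hMT)
  have hidx : ((identityComponent M).subgroupOf M).index ≠ 0 :=
    (finiteIndex_identityComponent hM).index_ne_zero
  obtain ⟨j, hj, -, hjm⟩ := Subgroup.exists_pow_mem_of_index_ne_zero hidx ⟨m, hm⟩
  refine ⟨j, hj, hle ?_⟩
  rw [Subgroup.mem_subgroupOf, Subgroup.coe_pow] at hjm
  exact hjm

end Rigidity

end Literature.NumberTheory.Automorphic
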